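import Literature.IUT.HodgeArakelov.ThetaSettingDeltaCharacteristicOfCentralizer
import Literature.IUT.HodgeArakelov.AbsTopMonoidsGenuineOfSettingTempered
import Literature.IUT.HodgeArakelov.MonoThetaProjectiveBridgeEtTh
import Literature.AnabelianGeometry.EtaleTheta.SettingModelTateTheta
import Literature.AnabelianGeometry.EtaleTheta.SettingModelTateGroupLevel
import Literature.AnabelianGeometry.EtaleTheta.SettingModelGfpTopologicallyFinitelyGenerated
import Literature.AnabelianGeometry.SemiGraphs.TemperedCurveDataNonVacuity
import Literature.AnabelianGeometry.AbsoluteAnabelian.AbsTopIChainsRemark422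
import Literature.AnabelianGeometry.AbsoluteAnabelian.SlimFiniteNormalProofs
import HarnessLib

/-!
# (H1) «`Δ ⊆ Π` characteristic» at the stage-2 [EtTh] Tate model, DISCHARGED modulo {the identification `Δ_E ≃ₜ* U ≤ F̂₂`,
# «`I_χ` meets every open subgroup of `G_{ℚ_p}`»} — the MCHAR binder `hΔX` of the Cor. 1.12 instance of record

S. Mochizuki, *Inter-universal Teichmüller theory II*, §1, Example 1.8 (i) (kurims p. 35): "the subgroup `Δ ⊆ Π` [...] may be
characterized group-theoretically" [claim: Mochizuki2012, status: disputed]; [AbsTopI] Thm 2.6 (iv)/(v) p. 22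
[cite: MochizukiAbsTopI2012, Thm 2.6 (v) p.22]; [EtTh] §1 p. 13 (the `G_K`-action on `Π_X` through `κ`, `χ`)
[cite: MochizukiEtTh2009, §1 p.13].

Cell `abc-iut`, seat abc-iut-w4-d044 (gen 7), row W1 «MCHAR-VIA-PROJECTIVITY (ii-b)» (abc-iut-L6-lead §F v1.19ck, basename approved),
file B = the MODEL INSTANTIATION of file A (`ThetaSetting.deltaX_characteristic_of_centralizer`).  PROOF-ONLY, 0 defs / instances /
named facts.  At the stage-2 model `D := ThetaSetting.modelχq p i j` (`Π^tp_X = Γ ⋊_{(κ^i, κ^j, χ)} G_{ℚ_p}`, `Γ = F̂₂ ×_Ẑ ℤ`;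
abc-iut-L2 / abc-iut-L6-d6) and ANY `X̲̲`-choice `C` with its [IUTchII] §1 setting `S := ThetaSetting.ofDoubleUnderline C μ …`
(`Π^{(S)} = C.Huu`; `EtaleLevels.setting C … = S` at level 1), the binders of file A are supplied as follows:
* `hopen` (open `aug_S`) ⟸ the §6 bundle `GroupLevelData (curveχq p i j)` (tempered + Galois-countable, abc-iut-L6-d6) through
  `isOpenMap_augGK_mk_of_groupLevelData` / `isOpenMap_aug_ofDoubleUnderline`;
* `hΔ` (`Δ^{(S)}` tfg) ⟸ `Γ` tfg (`SettingModel.isTopologicallyFinitelyGenerated_gfp`) via `Δ^tp_X ≃ₜ* Γ` and Schreier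
  (`isTopologicallyFinitelyGenerated_deltaX_ofDoubleUnderline`);
* `hslim` ⟸ `G_{ℚ_p}` slim ([pGC] Lem 15.8, `isSlimGroup_GQp`) transported to `Gal(K̄/K)` along `galoisIdentification`;
* the CENTRALISING subgroup `A₀ := C.Huu ∩ inr(I)`, **`I := Ker (tatePairHom p i j) = Ker κ_p ∩ Ker χ ≤ G_{ℚ_p}`** (the kernel of a
  landed homomorphism — no new definition): `actχq σ = affTwist₃Gfp (tatePairHom σ) = 1` for `σ ∈ I`, so `inr σ` commutes with
  `Δ^tp_X = inl(Γ)` (`SettingModel.inr_mem_centralizer_deltaX_of_mem_ker`);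
* the DENSITY clause `aug_S(A₀) ⊓ V ≠ ⊥` for open `V` ⟸ the ONE residual model hypothesis
  **`hI : ∀ V open ≤ G_{ℚ_p}, I ⊓ V ≠ ⊥`** («`I_χ = Gal(ℚ̄_p/ℚ_p(μ_∞, p^{1/∞}))` is infinite» — a CLASSICAL statement about the local
  field `ℚ_p` (Kummer theory of `ℚ_p(ζ_p)`), not available in the tree and NOT an anabelian input);
* the IDENTIFICATION `eΔ : Δ_E ≃ₜ* U`, `U` open in `F̂₂` — the binder of the re-slice «(ii-b)-IDENT» (uniqueness of profinite
  completions: `Δ_E` and the closure of `pr₁(Δ^{(S)})` in `F̂₂` are both profinite completions of `Δ^{(S)}`).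
RESULT `SettingModel.deltaX_characteristic_ofDoubleUnderline_modelχq`: **hΔX at `S` ⟸ {eΔ, hI}** — the K-L6 custody binder (H1)/MChar
(abc-iut-w4-d043 p466815 `hΔX ⟺ MChar`; the `hΔX` binder of the Cor. 1.12 (ii)(iii) instance of record p477403
`ModelTateCarriers.cor112_model_modelTate_section_translates`, which is re-instantiated by ONE application:
`cor112_model_modelTate_section_translates … (deltaX_characteristic_setting_modelχq … hI U hU eΔ) G`).

HONEST FRAMING: `modelχq` is a SEMI-SYNTHETIC model (binder-discharge / joint-satisfiability evidence for OUR typed interface, not the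
tempered `π₁` of a curve); `hI` and `eΔ` are explicit binders; classical group theory + [pGC] Lem 15.8 (proved in the tree); nothing
here bears on [IUTchIII] Cor. 3.12 or takes a side; typed ≠ proved elsewhere; instantiated ≠ endorsed; nothing asserts abc proved or
refuted.
-/

noncomputable section

namespace Literature.AnabelianGeometry.EtaleTheta.SettingModel

open Literature.AnabelianGeometry.AbsoluteAnabelian
open Literature.AnabelianGeometry.SemiGraphs
open Literature.AlgebraicGeometry.Frobenioids (IsSlimGroup)
open Literature.IUT.HodgeTheaters (profiniteCompletion)
open Literature.IUT.HodgeArakelov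

variable (p : ℕ) [Fact p.Prime] (i j : ℤ) (hj : Even j)

/-! ### The model inputs -/

/-- **`Δ^tp_X` of the stage-2 model is topologically finitely generated**: `Δ^tp_X = inl(Γ) ≃ₜ* Γ = F̂₂ ×_Ẑ ℤ`, and `Γ` is
topologically generated by the two graph elements (`isTopologicallyFinitelyGenerated_gfp`). [cite: MochizukiEtTh2009, §1 p.12] -/
theorem isTopologicallyFinitelyGenerated_deltaTempχq : IsTopologicallyFinitelyGenerated (curveχq p i j).DeltaTemp := by
  let e : Gfp ≃ₜ* (curveχq p i j).DeltaTemp :=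
    { toFun := fun γ => ⟨SemidirectProduct.inl γ, inl_mem_deltaTempχq p i j γ⟩
      invFun := fun g => g.1.left
      left_inv := fun γ => rfl
      right_inv := fun g => by
        apply Subtype.ext
        change SemidirectProduct.inl g.1.left = g.1
        have hg : g.1.right = 1 := (mem_deltaTempχq_iff p i j g.1).mp g.2
        rw [← SemidirectProduct.inl_left_mul_inr_right g.1, hg, map_one, mul_one]
        rfl
      map_mul' := fun a b => Subtype.ext (map_mul _ a b)
      continuous_toFun := (continuous_inlχq p i j).subtype_mk _
      continuous_invFun :=
        (Semidirect.continuous_left (isInducing_leftRightχq p i j)).comp continuous_subtype_val }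
  exact isTopologicallyFinitelyGenerated_gfp.of_continuousMulEquiv e

/-- For `σ ∈ I = Ker (tatePairHom)` the stage-2 action is trivial: `actχq σ = 1`. [cite: MochizukiEtTh2009, §1 p.13] -/
theorem actχq_eq_one_of_mem_ker {σ : GQp p} (hσ : σ ∈ (tatePairHom p i j).ker) : actχq p i j σ = 1 := by
  change affTwist₃Gfp (tatePairHom p i j σ) = 1
  rw [MonoidHom.mem_ker.mp hσ, map_one]

/-- `inr σ` commutes with every element of `Δ^tp_X = {g | g.right = 1}` when `σ ∈ I`. [cite: MochizukiEtTh2009, §1 p.13] -/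
theorem inr_comm_of_mem_ker_of_right_eq_one {σ : GQp p} (hσ : σ ∈ (tatePairHom p i j).ker) (d : PiTpχq p i j)
    (hd : d.right = 1) : d * SemidirectProduct.inr σ = SemidirectProduct.inr σ * d := by
  have hact := actχq_eq_one_of_mem_ker p i j hσ
  refine SemidirectProduct.ext ?_ ?_
  · rw [SemidirectProduct.mul_left, SemidirectProduct.mul_left, SemidirectProduct.left_inr,
      SemidirectProduct.right_inr, hd, hact, map_one, MulAut.one_apply, mul_one, one_mul]
  · rw [SemidirectProduct.mul_right, SemidirectProduct.mul_right, SemidirectProduct.right_inr, hd, one_mul, mul_one]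

section Model

variable {ED : (ThetaSetting.modelχq p i j hj).EtaleThetaData} {l : ℕ} (C : ED.DoubleUnderline l) {N : ℕ+}
  (μ : (ThetaSetting.modelχq p i j hj).CyclotomeMod l N) (hC : (ThetaSetting.modelχq p i j hj).Compat)
  (hS : (ThetaSetting.modelχq p i j hj).Sec2Hyps) (hl : l.Prime) (hp2 : p ≠ 2) (hpl : p ≠ l)
  (hζ : ∃ ζ : (ThetaSetting.modelχq p i j hj).K, IsPrimitiveRoot ζ (4 * l))
  {η : (C.thetaEnvData μ hC hS).PiYdd → MuN p N} (hη : η ∈ (C.thetaEnvData μ hC hS).thetaCocycles)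

/-- The centralising subgroup of the route at the model: `A₀ := C.Huu ∩ inr(I)` CENTRALISES `Δ^{(S)} = C.Huu ∩ Δ^tp_X` inside
`Π^{(S)} = C.Huu`. [cite: MochizukiEtTh2009, §1 p.13] -/
theorem inrKer_subgroupOf_le_centralizer_deltaX :
    (((tatePairHom p i j).ker.map (SemidirectProduct.inr : GQp p →* PiTpχq p i j)).subgroupOf C.Huu :
        Subgroup (ThetaSetting.ofDoubleUnderline C μ hC hS hl hp2 hpl hζ hη).PiX) ≤
      Subgroup.centralizer (((ThetaSetting.ofDoubleUnderline C μ hC hS hl hp2 hpl hζ hη).DeltaX :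
        Subgroup (ThetaSetting.ofDoubleUnderline C μ hC hS hl hp2 hpl hζ hη).PiX) :
          Set (ThetaSetting.ofDoubleUnderline C μ hC hS hl hp2 hpl hζ hη).PiX) := by
  intro x hx
  obtain ⟨σ, hσ, hσx⟩ := Subgroup.mem_subgroupOf.mp hx
  refine Subgroup.mem_centralizer_iff.mpr fun d hd => ?_
  have hd' : ((show C.Huu from d) : PiTpχq p i j).right = 1 :=
    (mem_deltaTempχq_iff p i j _).mp ((ThetaSetting.mem_deltaX_ofDoubleUnderline_iff C μ hC hS hl hp2 hpl hζ hη d).mp hd)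
  apply Subtype.ext
  change ((show C.Huu from d) : PiTpχq p i j) * ((show C.Huu from x) : PiTpχq p i j) =
    ((show C.Huu from x) : PiTpχq p i j) * ((show C.Huu from d) : PiTpχq p i j)
  rw [← hσx]
  exact inr_comm_of_mem_ker_of_right_eq_one p i j hσ _ hd'

/-- The density clause at the model: if `I` meets every open subgroup of `G_{ℚ_p}`, then `aug_S(A₀)` meets every open subgroup of
`G_K` (`aug_S (inr σ) = σ`; `inr⁻¹(C.Huu)` is open). [cite: MochizukiEtTh2009, §1 p.13] -/
theorem map_aug_inrKer_inf_ne_bot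
    (hI : ∀ V : Subgroup (GQp p), IsOpen (V : Set (GQp p)) → (tatePairHom p i j).ker ⊓ V ≠ ⊥)
    (V : Subgroup (ThetaSetting.ofDoubleUnderline C μ hC hS hl hp2 hpl hζ hη).Gk)
    (hV : IsOpen (V : Set (ThetaSetting.ofDoubleUnderline C μ hC hS hl hp2 hpl hζ hη).Gk)) :
    (((tatePairHom p i j).ker.map (SemidirectProduct.inr : GQp p →* PiTpχq p i j)).subgroupOf C.Huu :
        Subgroup (ThetaSetting.ofDoubleUnderline C μ hC hS hl hp2 hpl hζ hη).PiX).map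
      (ThetaSetting.ofDoubleUnderline C μ hC hS hl hp2 hpl hζ hη).aug ⊓ V ≠ ⊥ := by
  haveI : IsGalois ℚ_[p] (AlgebraicClosure ℚ_[p]) := {}
  -- the open subgroups `W := inr⁻¹(C.Huu)` of `G_{ℚ_p}` and `V' :=` the image of `V` in `G_{ℚ_p}`
  set W : Subgroup (GQp p) := C.Huu.comap (SemidirectProduct.inr : GQp p →* PiTpχq p i j) with hWdef
  have hWo : IsOpen (W : Set (GQp p)) := C.isOpen_Huu.preimage (continuous_inrχq p i j)
  set V' : Subgroup (GQp p) := V.map (ThetaSetting.modelχq p i j hj).GK.subtype with hV'def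
  have hGKo : IsOpen (((ThetaSetting.modelχq p i j hj).GK : Subgroup (GQp p)) : Set (GQp p)) :=
    IntermediateField.fixingSubgroup_isOpen _
  have hV'o : IsOpen (V' : Set (GQp p)) := by
    rw [hV'def, Subgroup.coe_map]
    exact hGKo.isOpenMap_subtype_val _ hV
  have hWV : IsOpen ((W ⊓ V' : Subgroup (GQp p)) : Set (GQp p)) := by
    rw [Subgroup.coe_inf]
    exact hWo.inter hV'o
  -- a non-trivial `τ ∈ I ∩ W ∩ V'`
  intro hbot
  apply hI (W ⊓ V') hWV
  rw [eq_bot_iff]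
  rintro τ ⟨hτI, hτW, hτV'⟩
  obtain ⟨⟨v, hvGK⟩, hvV, hvτ⟩ := hτV'
  change v = τ at hvτ
  subst hvτ
  -- `x := inr v ∈ A₀` with `aug_S x = ⟨v, _⟩ ∈ V`
  have hxA : (⟨SemidirectProduct.inr v, hτW⟩ : C.Huu) ∈
      (((tatePairHom p i j).ker.map (SemidirectProduct.inr : GQp p →* PiTpχq p i j)).subgroupOf C.Huu) :=
    Subgroup.mem_subgroupOf.mpr ⟨v, hτI, rfl⟩
  have haug : (ThetaSetting.ofDoubleUnderline C μ hC hS hl hp2 hpl hζ hη).aug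
      (show (ThetaSetting.ofDoubleUnderline C μ hC hS hl hp2 hpl hζ hη).PiX from
        (⟨SemidirectProduct.inr v, hτW⟩ : C.Huu)) = ⟨v, hvGK⟩ :=
    Subtype.ext rfl
  have hmem : (⟨v, hvGK⟩ : (ThetaSetting.modelχq p i j hj).GK) ∈
      (((tatePairHom p i j).ker.map (SemidirectProduct.inr : GQp p →* PiTpχq p i j)).subgroupOf C.Huu :
          Subgroup (ThetaSetting.ofDoubleUnderline C μ hC hS hl hp2 hpl hζ hη).PiX).map
        (ThetaSetting.ofDoubleUnderline C μ hC hS hl hp2 hpl hζ hη).aug ⊓ V :=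
    ⟨⟨_, hxA, haug⟩, hvV⟩
  rw [hbot] at hmem
  have h1 : (⟨v, hvGK⟩ : (ThetaSetting.modelχq p i j hj).GK) = 1 := Subgroup.mem_bot.mp hmem
  rw [Subgroup.mem_bot]
  exact congrArg Subtype.val h1

/-- **(H1) «`Δ^{(S)} ⊆ Π^{(S)}` is characteristic» AT THE STAGE-2 MODEL, modulo {`eΔ`, `hI`}**: for EVERY `X̲̲`-choice `C` over
`modelχq p i j` and its [IUTchII] §1 setting `S := ThetaSetting.ofDoubleUnderline C μ …`, given the identification
`eΔ : Δ_E ≃ₜ* U` of the geometric part of THE completion package of `S` with an open subgroup `U ≤ F̂₂` and the model hypothesis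
«`I = Ker κ_p ∩ Ker χ` meets every open subgroup of `G_{ℚ_p}`», every automorphism of topological groups of `Π^{(S)} = C.Huu`
carries `Δ^{(S)}` onto itself.  File A at the model inputs above; (H′) is the tree's theorem
`IsProSigmaCompletion.centralizer_eq_bot_of_normal`. [claim: Mochizuki2012, status: disputed] (IUTchII §1 Ex 1.8 (i), kurims p.35)
[cite: MochizukiAbsTopI2012, Thm 2.6 (v) p.22] -/
theorem deltaX_characteristic_ofDoubleUnderline_modelχq
    (hI : ∀ V : Subgroup (GQp p), IsOpen (V : Set (GQp p)) → (tatePairHom p i j).ker ⊓ V ≠ ⊥)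
    (U : Subgroup (profiniteCompletion (FreeGroup (Fin 2)))) (hU : IsOpen (U : Set (profiniteCompletion (FreeGroup (Fin 2)))))
    (eΔ : ((ThetaSetting.ofDoubleUnderline C μ hC hS hl hp2 hpl hζ hη).completionPackage (ThetaSetting.modelχq p i j hj).K
        (ThetaSetting.modelχq p i j hj).toTemperedCurve.galoisIdentification).geom ≃ₜ* U) :
    ∀ φ : (ThetaSetting.ofDoubleUnderline C μ hC hS hl hp2 hpl hζ hη).PiX ≃ₜ*
        (ThetaSetting.ofDoubleUnderline C μ hC hS hl hp2 hpl hζ hη).PiX,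
      (ThetaSetting.ofDoubleUnderline C μ hC hS hl hp2 hpl hζ hη).DeltaX.map φ.toMulEquiv.toMonoidHom =
        (ThetaSetting.ofDoubleUnderline C μ hC hS hl hp2 hpl hζ hη).DeltaX := by
  haveI : IsGalois ℚ_[p] (AlgebraicClosure ℚ_[p]) := {}
  obtain ⟨d⟩ := nonempty_groupLevelData_curveχq_holds p i j
  -- open `aug_S`
  have hopen : IsOpenMap (ThetaSetting.ofDoubleUnderline C μ hC hS hl hp2 hpl hζ hη).aug :=
    ThetaSetting.isOpenMap_aug_ofDoubleUnderline C μ hC hS hl hp2 hpl hζ hη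
      ((ThetaSetting.modelχq p i j hj).isOpenMap_augGK_mk_of_groupLevelData d)
  -- `Δ^{(S)}` tfg
  have hΔ : IsTopologicallyFinitelyGenerated (ThetaSetting.ofDoubleUnderline C μ hC hS hl hp2 hpl hζ hη).DeltaX :=
    ThetaSetting.isTopologicallyFinitelyGenerated_deltaX_ofDoubleUnderline C μ hC hS hl hp2 hpl hζ hη
      (isTopologicallyFinitelyGenerated_deltaTempχq p i j)
  -- `Gal(K̄/K)` slim
  have hGK : IsSlimGroup (ThetaSetting.modelχq p i j hj).GK :=
    (TemperedCurve.isSlimGroup_GQp (p := p)).subgroup_of_isOpen _ (IntermediateField.fixingSubgroup_isOpen _)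
  have hslim : IsSlimGroup ((ThetaSetting.ofDoubleUnderline C μ hC hS hl hp2 hpl hζ hη).completionPackage
      (ThetaSetting.modelχq p i j hj).K (ThetaSetting.modelχq p i j hj).toTemperedCurve.galoisIdentification).gal :=
    IsSlimGroup.of_continuousMulEquiv' (ThetaSetting.modelχq p i j hj).toTemperedCurve.galoisIdentification hGK
  exact ThetaSetting.deltaX_characteristic_of_centralizer (ThetaSetting.ofDoubleUnderline C μ hC hS hl hp2 hpl hζ hη)
    (ThetaSetting.modelχq p i j hj).K (ThetaSetting.modelχq p i j hj).toTemperedCurve.galoisIdentification p hopen hΔ hslim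
    _ (inrKer_subgroupOf_le_centralizer_deltaX p i j hj C μ hC hS hl hp2 hpl hζ hη)
    (map_aug_inrKer_inf_ne_bot p i j hj C μ hC hS hl hp2 hpl hζ hη hI) le_rfl U hU eΔ

/-- **The `hΔX` binder of the Cor. 1.12 (ii)(iii) instance of record, SUPPLIED modulo {eΔ, hI}**: the same at abc-iut-w4-d030's
`EtaleLevels.setting C hC hS hl hp2 hpl hζ mods f hf` (= the level-`1` `ofDoubleUnderline`, definitionally), so that
`ModelTateCarriers.cor112_model_modelTate_section_translates … (deltaX_characteristic_setting_modelχq …) G` (p477403, at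
`(i, j) = (1, 2)`) has residual ∀-binders {`hP`, `h218i₁`, `hcharY`, `huniq`, `G`} ∪ {`eΔ`, `hI`} — no MChar.
[claim: Mochizuki2012, status: disputed] (IUTchII §1 Ex 1.8 (i), kurims p.35) [cite: MochizukiAbsTopI2012, Thm 2.6 (v) p.22] -/
theorem deltaX_characteristic_setting_modelχq (mods : ∀ M : ℕ+, (ThetaSetting.modelχq p i j hj).CyclotomeMod l M)
    (f : _) (hf : f ∈ C.rootCocycles hC)
    (hI : ∀ V : Subgroup (GQp p), IsOpen (V : Set (GQp p)) → (tatePairHom p i j).ker ⊓ V ≠ ⊥)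
    (U : Subgroup (profiniteCompletion (FreeGroup (Fin 2)))) (hU : IsOpen (U : Set (profiniteCompletion (FreeGroup (Fin 2)))))
    (eΔ : ((EtaleLevels.setting C hC hS hl hp2 hpl hζ mods f hf).completionPackage (ThetaSetting.modelχq p i j hj).K
        (ThetaSetting.modelχq p i j hj).toTemperedCurve.galoisIdentification).geom ≃ₜ* U) :
    ∀ φ : (EtaleLevels.setting C hC hS hl hp2 hpl hζ mods f hf).PiX ≃ₜ* (EtaleLevels.setting C hC hS hl hp2 hpl hζ mods f hf).PiX,
      (EtaleLevels.setting C hC hS hl hp2 hpl hζ mods f hf).DeltaX.map φ.toMulEquiv.toMonoidHom =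
        (EtaleLevels.setting C hC hS hl hp2 hpl hζ mods f hf).DeltaX :=
  deltaX_characteristic_ofDoubleUnderline_modelχq p i j hj C (mods 1) hC hS hl hp2 hpl hζ
    (EtaleLevels.eta0_mem C hC hS mods f hf 1) hI U hU eΔ

end Model

/-! ### v2 (append-only): the weakest display form of the model hypothesis — `hI0 : Ker (tatePairHom) ≠ ⊥`
(abc-iut-L6-lead §F 01:42:03Z (2): «the stage-2 Tate character pair is not injective on `G_{ℚ_p}`») -/

/-- In the SLIM profinite `G_{ℚ_p}` ([pGC] Lem 15.8, `isSlimGroup_GQp`) a non-trivial normal subgroup meets every open subgroup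
non-trivially: if `I ⊓ V = ⊥` for an open `V`, then `I` embeds in the finite `G_{ℚ_p}/V`, so `I` is a FINITE normal subgroup of a slim
group, hence trivial (`eq_bot_of_finite_normal_of_isSlimGroup`, [AbsTopI] §0 p. 8). [cite: MochizukiAbsTopI2012, §0 p.8] -/
theorem ker_tatePairHom_inf_ne_bot_of_ne_bot (hI0 : (tatePairHom p i j).ker ≠ ⊥) :
    ∀ V : Subgroup (GQp p), IsOpen (V : Set (GQp p)) → (tatePairHom p i j).ker ⊓ V ≠ ⊥ := by
  intro V hV hbot
  haveI : IsGalois ℚ_[p] (AlgebraicClosure ℚ_[p]) := {}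
  haveI : T2Space (GQp p) := krullTopology_t2
  haveI : Finite (GQp p ⧸ V) := Subgroup.quotient_finite_of_isOpen V hV
  have hinj : Function.Injective fun k : (tatePairHom p i j).ker => (QuotientGroup.mk (k : GQp p) : GQp p ⧸ V) := by
    intro a b hab
    have hV' : (a : GQp p)⁻¹ * b ∈ V := QuotientGroup.eq.mp hab
    have hk : (a : GQp p)⁻¹ * b ∈ (tatePairHom p i j).ker := mul_mem (inv_mem a.2) b.2
    have hmem : (a : GQp p)⁻¹ * b ∈ (tatePairHom p i j).ker ⊓ V := ⟨hk, hV'⟩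
    rw [hbot, Subgroup.mem_bot, inv_mul_eq_one] at hmem
    exact Subtype.ext hmem
  haveI : Finite (tatePairHom p i j).ker := Finite.of_injective _ hinj
  exact hI0 (eq_bot_of_finite_normal_of_isSlimGroup (TemperedCurve.isSlimGroup_GQp (p := p)) _ (Set.toFinite _))

section ModelWeak

variable {ED : (ThetaSetting.modelχq p i j hj).EtaleThetaData} {l : ℕ} (C : ED.DoubleUnderline l) {N : ℕ+}
  (μ : (ThetaSetting.modelχq p i j hj).CyclotomeMod l N) (hC : (ThetaSetting.modelχq p i j hj).Compat)
  (hS : (ThetaSetting.modelχq p i j hj).Sec2Hyps) (hl : l.Prime) (hp2 : p ≠ 2) (hpl : p ≠ l)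
  (hζ : ∃ ζ : (ThetaSetting.modelχq p i j hj).K, IsPrimitiveRoot ζ (4 * l))
  {η : (C.thetaEnvData μ hC hS).PiYdd → MuN p N} (hη : η ∈ (C.thetaEnvData μ hC hS).thetaCocycles)

/-- **(H1) at the stage-2 model modulo {`eΔ`, `hI0 : Ker (tatePairHom) ≠ ⊥`}** — the K-L6 display form: the anabelian MChar input is
replaced by the identification binder and the ONE classical local statement «the Tate character pair `σ ↦ ((κ_p σ^i, κ_p σ^j), χ σ)` is
NOT injective on `G_{ℚ_p}`» (`I_χ ≠ 1`). [claim: Mochizuki2012, status: disputed] (IUTchII §1 Ex 1.8 (i), kurims p.35)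
[cite: MochizukiAbsTopI2012, Thm 2.6 (v) p.22] -/
theorem deltaX_characteristic_ofDoubleUnderline_modelχq_of_ker_ne_bot (hI0 : (tatePairHom p i j).ker ≠ ⊥)
    (U : Subgroup (profiniteCompletion (FreeGroup (Fin 2)))) (hU : IsOpen (U : Set (profiniteCompletion (FreeGroup (Fin 2)))))
    (eΔ : ((ThetaSetting.ofDoubleUnderline C μ hC hS hl hp2 hpl hζ hη).completionPackage (ThetaSetting.modelχq p i j hj).K
        (ThetaSetting.modelχq p i j hj).toTemperedCurve.galoisIdentification).geom ≃ₜ* U) :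
    ∀ φ : (ThetaSetting.ofDoubleUnderline C μ hC hS hl hp2 hpl hζ hη).PiX ≃ₜ*
        (ThetaSetting.ofDoubleUnderline C μ hC hS hl hp2 hpl hζ hη).PiX,
      (ThetaSetting.ofDoubleUnderline C μ hC hS hl hp2 hpl hζ hη).DeltaX.map φ.toMulEquiv.toMonoidHom =
        (ThetaSetting.ofDoubleUnderline C μ hC hS hl hp2 hpl hζ hη).DeltaX :=
  deltaX_characteristic_ofDoubleUnderline_modelχq p i j hj C μ hC hS hl hp2 hpl hζ hη
    (ker_tatePairHom_inf_ne_bot_of_ne_bot p i j hI0) U hU eΔ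

/-- The same at `EtaleLevels.setting C … mods f hf` (the `hΔX` binder of p477403), display form {`eΔ`, `hI0`}.
[claim: Mochizuki2012, status: disputed] (IUTchII §1 Ex 1.8 (i), kurims p.35) [cite: MochizukiAbsTopI2012, Thm 2.6 (v) p.22] -/
theorem deltaX_characteristic_setting_modelχq_of_ker_ne_bot (mods : ∀ M : ℕ+, (ThetaSetting.modelχq p i j hj).CyclotomeMod l M)
    (f : _) (hf : f ∈ C.rootCocycles hC) (hI0 : (tatePairHom p i j).ker ≠ ⊥)
    (U : Subgroup (profiniteCompletion (FreeGroup (Fin 2)))) (hU : IsOpen (U : Set (profiniteCompletion (FreeGroup (Fin 2)))))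
    (eΔ : ((EtaleLevels.setting C hC hS hl hp2 hpl hζ mods f hf).completionPackage (ThetaSetting.modelχq p i j hj).K
        (ThetaSetting.modelχq p i j hj).toTemperedCurve.galoisIdentification).geom ≃ₜ* U) :
    ∀ φ : (EtaleLevels.setting C hC hS hl hp2 hpl hζ mods f hf).PiX ≃ₜ* (EtaleLevels.setting C hC hS hl hp2 hpl hζ mods f hf).PiX,
      (EtaleLevels.setting C hC hS hl hp2 hpl hζ mods f hf).DeltaX.map φ.toMulEquiv.toMonoidHom =
        (EtaleLevels.setting C hC hS hl hp2 hpl hζ mods f hf).DeltaX :=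
  deltaX_characteristic_setting_modelχq p i j hj C hC hS hl hp2 hpl hζ mods f hf
    (ker_tatePairHom_inf_ne_bot_of_ne_bot p i j hI0) U hU eΔ

end ModelWeak

end Literature.AnabelianGeometry.EtaleTheta.SettingModel

end
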